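import Summits.PneNP.PneNP.Theorems.KarlinRubinMonotoneSufficesRoomParamsSize

/-!
# Crux `MonotoneSuffices` (stmt-PneNP-18026), the GREEDY general detector — part 10e: the size exponent

The size of the greedy detector is `≤ (R+1) · 301 · (n+t+M+3)^6` with `R + 1 ≤ (L+3) (16n/k)^t / 2^{t(t-1)/2}`
trials (`t` levels, `k = ⌈n^{1/2-δ}⌉`). Since `log₂(16n/k) ≤ 4 + (1/2+δ) log₂ n` and
`t ≤ T = 2δ log₂ n + 6 log₂(L+1) + 2`, the exponent `t log₂(16n/k) - t(t-1)/2` is at most its value at `T`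
(the quadratic is increasing up to `4.5 + (1/2+δ) log₂ n ≥ T`), which is `δ log₂² n + O(log n · log log n)`:
`sizeExponent_le`. Hence the size is `≤ n^{(δ+ε) log₂ n}` eventually (`greedySize_le`). Real analysis only.
-/

set_option linter.dupNamespace false -- `Summit.PneNP.PneNP.…`: summit = sub-problem name (D-0017 single-conjunct layout)

namespace Summit.PneNP.PneNP.Theorems.MonotoneSuffices.Greedy

open Real Finset
open Summit.PneNP.PneNP.Theorems.MonotoneSuffices.Room

/-- **The exponent of the number of trials.** With `ℓ = log₂ n`, `u = log₂ (L+1)`: if `t ≤ 2δℓ + 6u + 2`,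
`6u + 2 ≤ 4.5 + (1/2-δ) ℓ` and `(1/2-δ) ℓ ≤ log₂ k`, then
`t (4 + ℓ - log₂ k) - t(t-1)/2 ≤ δ ℓ² + (24 u + 12) ℓ`. [folklore] -/
theorem sizeExponent_le {δ ℓ u lk t : ℝ} (hδ : 0 < δ) (hδ' : δ < 1 / 2) (hℓ : 1 ≤ ℓ) (hu : 0 ≤ u) (ht0 : 0 ≤ t)
    (ht : t ≤ 2 * δ * ℓ + 6 * u + 2) (hS1 : 6 * u + 2 ≤ 4.5 + (1 / 2 - δ) * ℓ) (hlk : (1 / 2 - δ) * ℓ ≤ lk) :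
    t * (4 + ℓ - lk) - t * (t - 1) / 2 ≤ δ * ℓ ^ 2 + (24 * u + 12) * ℓ := by
  set T := 2 * δ * ℓ + 6 * u + 2 with hT
  set a := 4.5 + (1 / 2 + δ) * ℓ with ha
  -- `t (4 + ℓ - lk) - t(t-1)/2 ≤ g t = t (a - t/2)`
  have h1 : t * (4 + ℓ - lk) - t * (t - 1) / 2 ≤ t * (a - t / 2) := by
    have : t * (4 + ℓ - lk) ≤ t * (4 + (1 / 2 + δ) * ℓ) := mul_le_mul_of_nonneg_left (by linarith) ht0
    rw [ha]; nlinarith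
  -- `g` is increasing up to `a ≥ T ≥ t`
  have hTa : T ≤ a := by rw [hT, ha]; linarith
  have h2 : t * (a - t / 2) ≤ T * (a - T / 2) := by
    have : T * (a - T / 2) - t * (a - t / 2) = (T - t) * (a - (T + t) / 2) := by ring
    nlinarith
  -- `g T ≤ δ ℓ² + (24u + 12) ℓ`
  have h3 : T * (a - T / 2) ≤ δ * ℓ ^ 2 + (24 * u + 12) * ℓ := by
    have hval : T * (a - T / 2) = (2 * δ * ℓ + 6 * u + 2) * (3.5 + ℓ / 2 - 3 * u) := by rw [hT, ha]; ring
    rw [hval]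
    have hA : (2 * δ * ℓ + 6 * u + 2) * (3.5 + ℓ / 2 - 3 * u) ≤ (2 * δ * ℓ + 6 * u + 2) * (3.5 + ℓ / 2) := by
      have h0 : 0 ≤ 2 * δ * ℓ + 6 * u + 2 := by positivity
      nlinarith
    have hB : (2 * δ * ℓ + 6 * u + 2) * (3.5 + ℓ / 2) = δ * ℓ ^ 2 + 7 * δ * ℓ + (6 * u + 2) * (3.5 + ℓ / 2) := by ring
    have hC : (6 * u + 2) * (3.5 + ℓ / 2) ≤ (6 * u + 2) * (4 * ℓ) := mul_le_mul_of_nonneg_left (by linarith) (by positivity)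
    nlinarith
  linarith

/-- **The size of the greedy detector.** Under the base inequalities at `n` (with the log-slacks at `1/2 - δ` and `ε`),
`R (300 (n+t+M+3)^6) + R + 1 ≤ n^{(δ+ε) log₂ n}` whenever `R + 1 ≤ (L+3) (16 n/k)^t / 2^{t(t-1)/2}`. [folklore] -/
theorem greedySize_le {δ ε : ℝ} {n k L Q t M R : ℕ} (hδ : 0 < δ) (hδ' : δ < 1 / 2)
    (ht2Q : 2 ^ t ≤ 2 * Q) (hQk : Q * k ^ 2 ≤ n * (L + 1) ^ 6 + k ^ 2) (hk2 : k ^ 2 ≤ 4 * n)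
    (hn : 2048 ≤ n) (hL11 : 11 ≤ L) (hk0 : 0 < k) (htn : t ≤ n) (hMn : M + 3 ≤ n)
    (hkSq : (n : ℝ) ^ (1 - 2 * δ) ≤ (k : ℝ) ^ 2) (hk : (n : ℝ) ^ (1 / 2 - δ) ≤ k)
    (hS1 : 6 * Real.logb 2 ((L : ℝ) + 1) + 2 ≤ 4.5 + (1 / 2 - δ) * Real.logb 2 n)
    (hS2 : 64 + 26 * Real.logb 2 ((L : ℝ) + 1) ≤ ε * Real.logb 2 n)
    (hR : (R : ℝ) + 1 ≤ ((L : ℝ) + 3) * ((16 * (n : ℝ) / k) ^ t / (2 : ℝ) ^ (t * (t - 1) / 2))) :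
    (((R * (300 * (n + t + M + 3) ^ 6) + (R + 1)) : ℕ) : ℝ) ≤ (n : ℝ) ^ ((δ + ε) * Real.logb 2 n) := by
  have hn0 : (0 : ℝ) < n := by exact_mod_cast (show 0 < n by omega)
  have hk0' : (0 : ℝ) < k := by exact_mod_cast hk0
  set ℓ := Real.logb 2 (n : ℝ) with hℓ
  set u := Real.logb 2 ((L : ℝ) + 1) with hu
  have hℓ11 : 11 ≤ ℓ := by
    rw [hℓ, Real.le_logb_iff_rpow_le one_lt_two hn0]
    exact_mod_cast (show (2 : ℕ) ^ 11 ≤ n by norm_num; omega)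
  have hℓ1 : 1 ≤ ℓ := by linarith
  have hu0 : 0 ≤ u := Real.logb_nonneg one_lt_two (by have : (0:ℝ) ≤ L := Nat.cast_nonneg L; linarith)
  have hnℓ : (n : ℝ) = 2 ^ ℓ := by rw [hℓ, Real.rpow_logb two_pos (by norm_num) hn0]
  -- (1) `t ≤ 2δℓ + 6u + 2`: `2^t k² ≤ 4 n (L+1)^6` and `k² ≥ n^{1-2δ}`
  have ht_le : (t : ℝ) ≤ 2 * δ * ℓ + 6 * u + 2 := by
    have hnat : 2 ^ t * k ^ 2 ≤ 4 * n * (L + 1) ^ 6 := by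
      have h4 : 4 * n ≤ n * (L + 1) ^ 6 := by
        have : 4 ≤ (L + 1) ^ 6 := le_trans (by norm_num) (Nat.pow_le_pow_left (show 2 ≤ L + 1 by omega) 6)
        nlinarith
      calc 2 ^ t * k ^ 2 ≤ 2 * Q * k ^ 2 := Nat.mul_le_mul_right _ ht2Q
        _ = 2 * (Q * k ^ 2) := by ring
        _ ≤ 2 * (n * (L + 1) ^ 6 + k ^ 2) := Nat.mul_le_mul_left _ hQk
        _ ≤ 2 * (n * (L + 1) ^ 6 + n * (L + 1) ^ 6) := by omega
        _ = 4 * n * (L + 1) ^ 6 := by ring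
    have hreal : (2 : ℝ) ^ t * (k : ℝ) ^ 2 ≤ 4 * n * ((L : ℝ) + 1) ^ 6 := by exact_mod_cast hnat
    have hsplit : (n : ℝ) = (n : ℝ) ^ (2 * δ) * (n : ℝ) ^ (1 - 2 * δ) := by
      rw [← Real.rpow_add hn0]; norm_num
    have hpow0 : (0 : ℝ) < (n : ℝ) ^ (1 - 2 * δ) := Real.rpow_pos_of_pos hn0 _
    have h2t : (2 : ℝ) ^ t ≤ 4 * ((L : ℝ) + 1) ^ 6 * (n : ℝ) ^ (2 * δ) := by
      have h1 : (2 : ℝ) ^ t * (n : ℝ) ^ (1 - 2 * δ) ≤ (4 * ((L : ℝ) + 1) ^ 6 * (n : ℝ) ^ (2 * δ)) * (n : ℝ) ^ (1 - 2 * δ) := by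
        calc (2 : ℝ) ^ t * (n : ℝ) ^ (1 - 2 * δ) ≤ (2 : ℝ) ^ t * (k : ℝ) ^ 2 := mul_le_mul_of_nonneg_left hkSq (by positivity)
          _ ≤ 4 * n * ((L : ℝ) + 1) ^ 6 := hreal
          _ = (4 * ((L : ℝ) + 1) ^ 6 * (n : ℝ) ^ (2 * δ)) * (n : ℝ) ^ (1 - 2 * δ) := by
              conv_lhs => rw [hsplit]
              ring
      exact le_of_mul_le_mul_right h1 hpow0
    have hlog := Real.logb_le_logb_of_le one_lt_two (by positivity) h2t
    rw [Real.logb_pow, Real.logb_self_eq_one one_lt_two, mul_one,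
      Real.logb_mul (by positivity) (by positivity), Real.logb_mul (by norm_num) (by positivity),
      Real.logb_rpow_eq_mul_logb_of_pos hn0, Real.logb_pow] at hlog
    have h4 : Real.logb 2 (4 : ℝ) = 2 := by
      rw [show (4 : ℝ) = 2 ^ (2 : ℕ) by norm_num, Real.logb_pow, Real.logb_self_eq_one one_lt_two]; norm_num
    rw [h4] at hlog
    push_cast at hlog
    linarith
  -- (2) `(1/2-δ) ℓ ≤ log₂ k`
  have hlk : (1 / 2 - δ) * ℓ ≤ Real.logb 2 k := by
    have := Real.logb_le_logb_of_le one_lt_two (Real.rpow_pos_of_pos hn0 _) hk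
    rwa [Real.logb_rpow_eq_mul_logb_of_pos hn0] at this
  -- (3) the exponent of the trials factor
  have hexp := sizeExponent_le hδ hδ' hℓ1 hu0 (Nat.cast_nonneg t) ht_le hS1 hlk
  have hT2 : ((t * (t - 1) / 2 : ℕ) : ℝ) = (t : ℝ) * ((t : ℝ) - 1) / 2 := by
    have heven : Even (t * (t - 1)) := Nat.even_mul_pred_self t
    have hdiv : (t * (t - 1) / 2) * 2 = t * (t - 1) := Nat.div_two_mul_two_of_even heven
    rcases Nat.eq_zero_or_pos t with ht0 | ht0
    · subst ht0; simp
    · have h := congrArg (fun m : ℕ => (m : ℝ)) hdiv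
      simp only [Nat.cast_mul, Nat.cast_ofNat, Nat.cast_sub ht0, Nat.cast_one] at h
      linarith
  have hbase : (16 * (n : ℝ) / k) = (2 : ℝ) ^ (4 + ℓ - Real.logb 2 k) := by
    rw [Real.rpow_sub two_pos, Real.rpow_add two_pos, ← hnℓ, Real.rpow_logb two_pos (by norm_num) hk0']
    norm_num
  have htrials : ((16 * (n : ℝ) / k) ^ t / (2 : ℝ) ^ (t * (t - 1) / 2)) =
      (2 : ℝ) ^ ((t : ℝ) * (4 + ℓ - Real.logb 2 k) - (t : ℝ) * ((t : ℝ) - 1) / 2) := by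
    rw [hbase, ← Real.rpow_natCast, ← Real.rpow_mul (by norm_num), Real.rpow_sub two_pos,
      ← Real.rpow_natCast (2 : ℝ) (t * (t - 1) / 2), hT2]
    ring_nf
  -- (4) the other factors as powers of two
  have hL3 : (L : ℝ) + 3 ≤ (2 : ℝ) ^ (u + 2) := by
    rw [Real.rpow_add two_pos, hu, Real.rpow_logb two_pos (by norm_num) (by positivity)]
    norm_num; linarith
  have hX6 : ((n : ℝ) + t + M + 3) ^ 6 ≤ (2 : ℝ) ^ (6 * (ℓ + 2)) := by
    have hX : ((n : ℝ) + t + M + 3) ≤ (2 : ℝ) ^ (ℓ + 2) := by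
      rw [Real.rpow_add two_pos, ← hnℓ]
      have h : n + t + M + 3 ≤ 3 * n := by omega
      have : ((n + t + M + 3 : ℕ) : ℝ) ≤ ((3 * n : ℕ) : ℝ) := by exact_mod_cast h
      push_cast at this
      norm_num; linarith
    calc ((n : ℝ) + t + M + 3) ^ 6 ≤ ((2 : ℝ) ^ (ℓ + 2)) ^ 6 := pow_le_pow_left₀ (by positivity) hX 6
      _ = (2 : ℝ) ^ (6 * (ℓ + 2)) := by rw [← Real.rpow_mul_natCast (by norm_num)]; ring_nf
  have h301 : (301 : ℝ) ≤ (2 : ℝ) ^ (9 : ℝ) := by norm_num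
  -- (5) assemble
  push_cast
  set X6 := ((n : ℝ) + t + M + 3) ^ 6 with hX6def
  have hX1 : (1 : ℝ) ≤ X6 := by
    rw [hX6def]; exact one_le_pow₀ (by have : (0 : ℝ) ≤ t := Nat.cast_nonneg t; have : (0 : ℝ) ≤ M := Nat.cast_nonneg M; linarith)
  have hR0 : (0 : ℝ) ≤ R := Nat.cast_nonneg R
  have hsize : (R : ℝ) * (300 * X6) + ((R : ℝ) + 1) ≤ ((R : ℝ) + 1) * (301 * X6) := by
    have e1 : (R : ℝ) ≤ R * X6 := le_mul_of_one_le_right hR0 hX1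
    linarith
  have hprod : ((R : ℝ) + 1) * (301 * X6) ≤
      ((2 : ℝ) ^ (u + 2) * (2 : ℝ) ^ ((t : ℝ) * (4 + ℓ - Real.logb 2 k) - (t : ℝ) * ((t : ℝ) - 1) / 2)) *
        ((2 : ℝ) ^ (9 : ℝ) * (2 : ℝ) ^ (6 * (ℓ + 2))) := by
    have hA : (R : ℝ) + 1 ≤ (2 : ℝ) ^ (u + 2) * (2 : ℝ) ^ ((t : ℝ) * (4 + ℓ - Real.logb 2 k) - (t : ℝ) * ((t : ℝ) - 1) / 2) := by
      rw [← htrials]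
      exact hR.trans (mul_le_mul_of_nonneg_right hL3 (by positivity))
    have hB : 301 * X6 ≤ (2 : ℝ) ^ (9 : ℝ) * (2 : ℝ) ^ (6 * (ℓ + 2)) :=
      mul_le_mul h301 hX6 (by positivity) (by positivity)
    exact mul_le_mul hA hB (by positivity) (by positivity)
  refine hsize.trans (hprod.trans ?_)
  rw [← Real.rpow_add two_pos, ← Real.rpow_add two_pos, ← Real.rpow_add two_pos, hnℓ, ← Real.rpow_mul (by norm_num)]
  refine Real.rpow_le_rpow_of_exponent_le one_le_two ?_
  -- exponent: `u + 2 + e_t + 9 + 6(ℓ+2) ≤ δℓ² + (25u + 41) ℓ ≤ (δ + ε) ℓ · ℓ`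
  have hE : u + 2 + ((t : ℝ) * (4 + ℓ - Real.logb 2 k) - (t : ℝ) * ((t : ℝ) - 1) / 2) + (9 + 6 * (ℓ + 2)) ≤
      δ * ℓ ^ 2 + (25 * u + 41) * ℓ := by
    have hul : u ≤ u * ℓ := le_mul_of_one_le_right hu0 hℓ1
    linarith
  have hF : δ * ℓ ^ 2 + (25 * u + 41) * ℓ ≤ ℓ * ((δ + ε) * ℓ) := by
    have h1 : 25 * u + 41 ≤ ε * ℓ := by linarith
    have h2 : (25 * u + 41) * ℓ ≤ (ε * ℓ) * ℓ := mul_le_mul_of_nonneg_right h1 (by linarith)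
    have h3 : ℓ * ((δ + ε) * ℓ) = δ * ℓ ^ 2 + (ε * ℓ) * ℓ := by ring
    rw [h3]
    linarith
  linarith

end Summit.PneNP.PneNP.Theorems.MonotoneSuffices.Greedy

namespace Summit.PneNP.PneNP.Theorems.MonotoneSuffices.Greedy

/-- Registered sub-goal `greedy_paramsS` of stmt-PneNP-18026 (greedy detector, part 10e): the exponent of the
number of trials, exported verbatim. [folklore] -/
theorem greedy_paramsS :
    ∀ {δ ℓ u lk t : ℝ}, 0 < δ → δ < 1 / 2 → 1 ≤ ℓ → 0 ≤ u → 0 ≤ t → t ≤ 2 * δ * ℓ + 6 * u + 2 → 6 * u + 2 ≤ 4.5 + (1 / 2 - δ) * ℓ → (1 / 2 - δ) * ℓ ≤ lk → t * (4 + ℓ - lk) - t * (t - 1) / 2 ≤ δ * ℓ ^ 2 + (24 * u + 12) * ℓ :=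
  fun hδ hδ' hℓ hu ht0 ht hS1 hlk => sizeExponent_le hδ hδ' hℓ hu ht0 ht hS1 hlk

end Summit.PneNP.PneNP.Theorems.MonotoneSuffices.Greedy
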